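import Literature.Probability.RandomPlanarGeometry.UnbasedLoopMeasurable
import HarnessLib

/-!
# Images of unbased loops under maps continuous on a subset

Lawler–Werner, *The Brownian loop soup*, PTRF **128** (2004) (**[LW04]**), §4.1, state the
conformal invariance of the Brownian loop measure as "`f ∘ μ^loop_D = μ^loop_{D'}`" for a conformal
transformation `f : D → D'`: the loop measure of `D` is pushed forward along `γ ↦ f ∘ γ`, a map
defined on the loops *lying in `D`* only (`f` is continuous on the open set `D` and in general has
no continuous extension). Lawler, J. Stat. Phys. **134** (2009) (**[Lawler2009]**), §2.2, uses the
same map to transport the events "the loop intersects `K`": `Λ(f(K₁), f(K₂); f(D)) = Λ(K₁, K₂; D)`.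
This file builds that map on the carrier `UnbasedLoop E` of the loop measure (closed curves modulo
orientation-preserving reparametrisation of the circle, `UnbasedLoopSpace`), for `f : E → E` and
`D ⊆ E`:

* `Curve.imageOn f D γ` — `f ∘ γ` when `f` is continuous on `D` and `range γ ⊆ D`, junk value `γ`
  otherwise; commutes with reparametrisations and changes of base point and respects
  reparametrisation / loop distance zero (`f` is uniformly continuous on the common compact
  trace), hence descends to `CurveClass.imageOn`, `BasedLoop.imageOn` and
  **`UnbasedLoop.imageOn f D`**, with `imageOn f D [γ] = [f ∘ γ]` (`imageOn_unroot`);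
* `UnbasedLoop.range_imageOn`, `mapsTo_imageOn` (loops in `D` go to loops in `D' ⊇ f(D)`),
  `imageOn_imageOn` (a left inverse of `f` on `D` induces one on loops in `D`),
  `imageOn_mem_hit_image_iff` (`f` injective on `D`, `K ⊆ D`: `[f ∘ γ]` hits `f(K)` iff `[γ]`
  hits `K`);
* `UnbasedLoop.continuousOn_imageOn`: for OPEN `D`, `imageOn f D` is continuous on the open set
  `inside D` (uniform continuity of `f` near a compact subset of `D`, a Lebesgue-number argument,
  `exists_forall_dist_lt_of_continuousOn`); `measurable_imageOn`: it is Borel measurable.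

Design: the junk value off `inside D` is the loop itself (a Borel self-map, no side condition).

## References

* G. F. Lawler, W. Werner, *The Brownian loop soup*, PTRF 128 (2004), §4.1 (Prop. 6).
* G. F. Lawler, *Partition functions, loop measure, and versions of SLE*, J. Stat. Phys. 134
  (2009), §2.2.
* M. Aizenman, A. Burchard, Duke Math. J. 99 (1999), §2.1 (curves modulo reparametrisation).
-/

noncomputable section

open Set Filter Metric MeasureTheory
open scoped unitInterval Topology

namespace Literature.Probability.RandomPlanarGeometry

/-- A map continuous on an open set `D` is uniformly continuous *near* every compact `K ⊆ D`: for
`ε > 0` there is `δ > 0` such that every point `y` within `δ` of a point `x ∈ K` lies in `D` and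
has `dist (f y) (f x) < ε` (Lebesgue number of the cover of `K` by the sets
`{y ∈ D | dist (f y) (f x) < ε/2}`). [folklore] -/
theorem exists_forall_dist_lt_of_continuousOn {X Y : Type*} [PseudoMetricSpace X]
    [PseudoMetricSpace Y] {f : X → Y} {D K : Set X} (hD : IsOpen D) (hf : ContinuousOn f D)
    (hK : IsCompact K) (hKD : K ⊆ D) {ε : ℝ} (hε : 0 < ε) :
    ∃ δ > 0, ∀ x ∈ K, ∀ y, dist y x < δ → y ∈ D ∧ dist (f y) (f x) < ε := by
  set c : K → Set X := fun x ↦ D ∩ f ⁻¹' ball (f x) (ε / 2) with hc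
  have hc₁ : ∀ i, IsOpen (c i) := fun i ↦ hf.isOpen_inter_preimage hD isOpen_ball
  have hc₂ : K ⊆ ⋃ i, c i := fun x hx ↦
    mem_iUnion.2 ⟨⟨x, hx⟩, hKD hx, by simp [half_pos hε]⟩
  obtain ⟨δ, hδ, hδc⟩ := lebesgue_number_lemma_of_metric hK hc₁ hc₂
  refine ⟨δ, hδ, fun x hx y hy ↦ ?_⟩
  obtain ⟨i, hi⟩ := hδc x hx
  have hyi : y ∈ c i := hi (mem_ball.2 hy)
  have hxi : x ∈ c i := hi (mem_ball_self hδ)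
  simp only [hc, mem_inter_iff, mem_preimage, mem_ball] at hyi hxi
  refine ⟨hyi.1, ?_⟩
  calc dist (f y) (f x) ≤ dist (f y) (f i) + dist (f x) (f i) := dist_triangle_right _ _ _
    _ < ε / 2 + ε / 2 := add_lt_add hyi.2 hxi.2
    _ = ε := add_halves ε

namespace Curve

/-! ### The image of a parametrised curve -/

section Topological

variable {E : Type*} [TopologicalSpace E] {f : E → E} {D : Set E}

open Classical in
/-- **The image `f ∘ γ` of a curve lying in a set `D` on which `f` is continuous** ([LW04] §4.1:
the loop measure is transported along `γ ↦ f ∘ γ` for `f` defined on `D` only). Junk value `γ`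
when `f` is not continuous on `D` or `γ` leaves `D`. [cite: LawlerWerner2004, §4.1] -/
def imageOn (f : E → E) (D : Set E) (γ : Curve E) : Curve E :=
  if h : ContinuousOn f D ∧ γ.range ⊆ D then
    ⟨⟨f ∘ γ, h.1.comp_continuous γ.continuous fun t ↦ h.2 ⟨t, rfl⟩⟩⟩
  else γ

/-- Pointwise formula for the image of a curve in `D`. [folklore] -/
theorem imageOn_apply (hf : ContinuousOn f D) {γ : Curve E} (hγ : γ.range ⊆ D) (t : I) :
    γ.imageOn f D t = f (γ t) := by
  rw [imageOn, dif_pos ⟨hf, hγ⟩]; rfl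

/-- The junk case of `imageOn`. [folklore] -/
theorem imageOn_of_not {γ : Curve E} (h : ¬ (ContinuousOn f D ∧ γ.range ⊆ D)) :
    γ.imageOn f D = γ := by
  rw [imageOn, dif_neg h]

/-- A curve leaving `D` is its own (junk) image. [folklore] -/
theorem imageOn_of_not_subset {γ : Curve E} (h : ¬ γ.range ⊆ D) : γ.imageOn f D = γ :=
  imageOn_of_not fun h' ↦ h h'.2

/-- The trace of the image is the image of the trace. [folklore] -/
theorem range_imageOn (hf : ContinuousOn f D) {γ : Curve E} (hγ : γ.range ⊆ D) :
    (γ.imageOn f D).range = f '' γ.range := by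
  rw [imageOn, dif_pos ⟨hf, hγ⟩]
  exact Set.range_comp f γ

/-- The image of a closed curve is closed. [folklore] -/
theorem IsLoop.imageOn {γ : Curve E} (hγ : γ.IsLoop) (f : E → E) (D : Set E) :
    (γ.imageOn f D).IsLoop := by
  by_cases h : ContinuousOn f D ∧ γ.range ⊆ D
  · rw [Curve.isLoop_iff, Curve.source_def, Curve.target_def, imageOn_apply h.1 h.2,
      imageOn_apply h.1 h.2]
    exact congrArg f hγ
  · rwa [imageOn_of_not h]

/-- Taking the image commutes with the change of base point of a closed curve. [folklore] -/
theorem imageOn_shift {γ : Curve E} (hγ : γ.IsLoop) (a : ℝ) :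
    (γ.shift a).imageOn f D = (γ.imageOn f D).shift a := by
  by_cases h : ContinuousOn f D ∧ γ.range ⊆ D
  · have h' : ContinuousOn f D ∧ (γ.shift a).range ⊆ D := by rwa [range_shift]
    apply DFunLike.coe_injective
    funext t
    rw [imageOn_apply h'.1 h'.2, shift_apply hγ, shift_apply (hγ.imageOn f D), loopMap_coe_eq,
      loopMap_coe_eq, imageOn_apply h.1 h.2]
  · have h' : ¬ (ContinuousOn f D ∧ (γ.shift a).range ⊆ D) := by rwa [range_shift]
    rw [imageOn_of_not h, imageOn_of_not h']

/-- A left inverse `g` of `f` on `D`, continuous on a set `D' ⊇ f(D)`, undoes `imageOn f D` on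
curves in `D`. [folklore] -/
theorem imageOn_imageOn {g : E → E} {D' : Set E} (hf : ContinuousOn f D) (hg : ContinuousOn g D')
    (hfD : MapsTo f D D') (hgf : LeftInvOn g f D) {γ : Curve E} (hγ : γ.range ⊆ D) :
    (γ.imageOn f D).imageOn g D' = γ := by
  have hγ' : (γ.imageOn f D).range ⊆ D' := by
    rw [range_imageOn hf hγ]
    exact (image_mono hγ).trans hfD.image_subset
  apply DFunLike.coe_injective
  funext t
  rw [imageOn_apply hg hγ', imageOn_apply hf hγ]
  exact hgf (hγ ⟨t, rfl⟩)

end Topological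

/-! ### Compatibility with the reparametrisation and loop distances -/

section Metric

variable {E : Type*} [MetricSpace E] {f : E → E} {D : Set E}

/-- If some reparametrisation of `β` is pointwise `δ`-close to `α`, where `δ` is a modulus of
uniform continuity of `f` for `ε` on a set containing both traces, then the images are at
reparametrisation distance `≤ ε`. [folklore] -/
theorem reparamDist_imageOn_le (hf : ContinuousOn f D) {α β : Curve E} (hα : α.range ⊆ D)
    (hβ : β.range ⊆ D) {ε : ℝ} (hε : 0 ≤ ε) (φ : I ≃o I)
    (H : ∀ t, dist (f (α t)) (f (β (φ t))) ≤ ε) :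
    reparamDist (α.imageOn f D) (β.imageOn f D) ≤ ε := by
  refine (reparamDist_le _ _ φ).trans ((ContinuousMap.dist_le hε).2 fun t ↦ ?_)
  change dist (α.imageOn f D t) ((β.imageOn f D).reparam φ t) ≤ ε
  rw [reparam_apply, imageOn_apply hf hα, imageOn_apply hf hβ]
  exact H t

/-- **`imageOn` respects reparametrisation distance zero**: `f` is uniformly continuous on the
common compact trace of two curves at distance `0` (Heine–Cantor), so close parametrisations
have close images. [folklore] -/
theorem dist_imageOn_imageOn_eq_zero {γ₁ γ₂ : Curve E} (h : dist γ₁ γ₂ = 0) :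
    dist (γ₁.imageOn f D) (γ₂.imageOn f D) = 0 := by
  have hr : γ₁.range = γ₂.range := range_eq_of_dist_eq_zero h
  by_cases hc : ContinuousOn f D ∧ γ₁.range ⊆ D
  · obtain ⟨hf, h₁⟩ := hc
    have h₂ : γ₂.range ⊆ D := hr ▸ h₁
    refine le_antisymm (le_of_forall_pos_le_add fun ε hε ↦ ?_) dist_nonneg
    rw [zero_add]
    have hu := γ₁.isCompact_range.uniformContinuousOn_of_continuous (hf.mono h₁)
    obtain ⟨δ, hδ, hfδ⟩ := Metric.uniformContinuousOn_iff.1 hu ε hε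
    obtain ⟨φ, hφ⟩ := exists_dist_reparam_lt (γ₁ := γ₁) (γ₂ := γ₂) (h ▸ hδ)
    refine reparamDist_imageOn_le hf h₁ h₂ hε.le φ fun t ↦ (hfδ _ ⟨t, rfl⟩ _ ?_ ?_).le
    · rw [hr]; exact ⟨φ t, rfl⟩
    · exact (ContinuousMap.dist_apply_le_dist (f := γ₁.toContinuousMap)
        (g := (γ₂.reparam φ).toContinuousMap) t).trans_lt hφ
  · have hc' : ¬ (ContinuousOn f D ∧ γ₂.range ⊆ D) := by rwa [← hr]
    rwa [imageOn_of_not hc, imageOn_of_not hc']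

/-- Closed curves at loop distance `0` have the same trace. [folklore] -/
theorem range_eq_of_loopDist_eq_zero {γ₁ γ₂ : Curve E} (h₁ : γ₁.IsLoop) (h₂ : γ₂.IsLoop)
    (h : loopDist γ₁ γ₂ = 0) : γ₁.range = γ₂.range :=
  BasedLoop.range_eq_of_dist_eq_zero (ℓ := BasedLoop.mk (CurveClass.mk γ₁) h₁)
    (ℓ' := BasedLoop.mk (CurveClass.mk γ₂) h₂) h

/-- **`imageOn` respects loop distance zero** (closed curves): if shifts and reparametrisations
of `γ₂` approximate `γ₁` uniformly, the same shifts and reparametrisations of `f ∘ γ₂`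
approximate `f ∘ γ₁` (`imageOn_shift` and uniform continuity of `f` on the common trace).
[folklore] -/
theorem loopDist_imageOn_imageOn_eq_zero {γ₁ γ₂ : Curve E} (hl₁ : γ₁.IsLoop) (hl₂ : γ₂.IsLoop)
    (h : loopDist γ₁ γ₂ = 0) : loopDist (γ₁.imageOn f D) (γ₂.imageOn f D) = 0 := by
  have hr : γ₁.range = γ₂.range := range_eq_of_loopDist_eq_zero hl₁ hl₂ h
  by_cases hc : ContinuousOn f D ∧ γ₁.range ⊆ D
  · obtain ⟨hf, h₁⟩ := hc
    have h₂ : γ₂.range ⊆ D := hr ▸ h₁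
    refine le_antisymm (le_of_forall_pos_le_add fun ε hε ↦ ?_) (loopDist_nonneg _ _)
    rw [zero_add]
    have hu := γ₁.isCompact_range.uniformContinuousOn_of_continuous (hf.mono h₁)
    obtain ⟨δ, hδ, hfδ⟩ := Metric.uniformContinuousOn_iff.1 hu ε hε
    have hlt : loopDist γ₁ γ₂ < δ := by rw [h]; exact hδ
    obtain ⟨b, hb⟩ : ∃ b : I, reparamDist γ₁ (γ₂.shift b) < δ := exists_lt_of_ciInf_lt hlt
    obtain ⟨φ, hφ⟩ := exists_dist_reparam_lt (γ₁ := γ₁) (γ₂ := γ₂.shift b) hb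
    have h₂b : (γ₂.shift b).range ⊆ D := by rw [range_shift]; exact h₂
    calc loopDist (γ₁.imageOn f D) (γ₂.imageOn f D)
        ≤ reparamDist (γ₁.imageOn f D) ((γ₂.imageOn f D).shift b) := loopDist_le _ _ b
      _ = reparamDist (γ₁.imageOn f D) ((γ₂.shift b).imageOn f D) := by
          rw [imageOn_shift hl₂]
      _ ≤ ε := by
          refine reparamDist_imageOn_le hf h₁ h₂b hε.le φ fun t ↦ (hfδ _ ⟨t, rfl⟩ _ ?_ ?_).le
          · rw [hr, ← range_shift γ₂ b]; exact ⟨φ t, rfl⟩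
          · exact (ContinuousMap.dist_apply_le_dist (f := γ₁.toContinuousMap)
              (g := ((γ₂.shift b).reparam φ).toContinuousMap) t).trans_lt hφ
  · have hc' : ¬ (ContinuousOn f D ∧ γ₂.range ⊆ D) := by rwa [← hr]
    rwa [imageOn_of_not hc, imageOn_of_not hc']

end Metric

end Curve

/-! ### Descent to curve classes, based loops and unbased loops -/

namespace CurveClass

variable {E : Type*} [MetricSpace E] {f : E → E} {D : Set E}

/-- The image of a curve class under a map continuous on `D` (junk: the class itself, when it
leaves `D`); well defined by `Curve.dist_imageOn_imageOn_eq_zero`. [folklore] -/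
def imageOn (f : E → E) (D : Set E) : CurveClass E → CurveClass E :=
  SeparationQuotient.lift (mk ∘ Curve.imageOn f D) fun _ _ h ↦
    mk_eq_mk_iff_dist_eq_zero.2 (Curve.dist_imageOn_imageOn_eq_zero (Metric.inseparable_iff.1 h))

/-- The image of the class of a curve. [folklore] -/
@[simp] theorem imageOn_mk (γ : Curve E) : imageOn f D (mk γ) = mk (γ.imageOn f D) := rfl

/-- The image of a loop class is a loop class. [folklore] -/
theorem IsLoop.imageOn {c : CurveClass E} (hc : c.IsLoop) (f : E → E) (D : Set E) :
    (c.imageOn f D).IsLoop := by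
  obtain ⟨γ, rfl⟩ := surjective_mk c
  exact Curve.IsLoop.imageOn hc f D

end CurveClass

namespace BasedLoop

variable {E : Type*} [MetricSpace E] {f : E → E} {D : Set E}

/-- The image of a based loop under a map continuous on `D`. [folklore] -/
def imageOn (f : E → E) (D : Set E) (ℓ : BasedLoop E) : BasedLoop E :=
  mk (ℓ.toCurveClass.imageOn f D) (ℓ.isLoop.imageOn f D)

/-- The curve class of the image of a based loop. [folklore] -/
@[simp] theorem toCurveClass_imageOn (ℓ : BasedLoop E) :
    (ℓ.imageOn f D).toCurveClass = ℓ.toCurveClass.imageOn f D := rfl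

/-- `BasedLoop.imageOn` respects loop distance zero. [folklore] -/
theorem dist_imageOn_imageOn_eq_zero {ℓ ℓ' : BasedLoop E} (h : dist ℓ ℓ' = 0) :
    dist (ℓ.imageOn f D) (ℓ'.imageOn f D) = 0 := by
  obtain ⟨c, hc⟩ := ℓ
  obtain ⟨c', hc'⟩ := ℓ'
  obtain ⟨γ, rfl⟩ := CurveClass.surjective_mk c
  obtain ⟨γ', rfl⟩ := CurveClass.surjective_mk c'
  exact Curve.loopDist_imageOn_imageOn_eq_zero hc hc' h

end BasedLoop

namespace UnbasedLoop

variable {E : Type*} [MetricSpace E] {f g : E → E} {D D' : Set E}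

/-- **The image of an unbased loop under a map continuous on `D`**: `[γ] ↦ [f ∘ γ]` for loops
lying in `D` ([LW04] §4.1, the map along which "`f ∘ μ^loop_D = μ^loop_{D'}`"; [Lawler2009]
§2.2), the identity (junk) on loops leaving `D`. [cite: LawlerWerner2004, §4.1] -/
def imageOn (f : E → E) (D : Set E) : UnbasedLoop E → UnbasedLoop E :=
  SeparationQuotient.lift (mk ∘ BasedLoop.imageOn f D) fun _ _ h ↦
    mk_eq_mk.2 (BasedLoop.dist_imageOn_imageOn_eq_zero (Metric.inseparable_iff.1 h))

/-- The image of the unbased loop of a based loop. [folklore] -/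
@[simp] theorem imageOn_mk (ℓ : BasedLoop E) : imageOn f D (mk ℓ) = mk (ℓ.imageOn f D) := rfl

/-- **`imageOn f D [γ] = [f ∘ γ]`** for a closed parametrised curve `γ` (with `Curve.imageOn`'s
junk convention). [folklore] -/
theorem imageOn_unroot (γ : {γ : Curve E // γ.IsLoop}) :
    imageOn f D (Curve.unroot γ) = Curve.unroot ⟨γ.1.imageOn f D, γ.2.imageOn f D⟩ := rfl

/-- Every unbased loop is `[γ]` for a closed parametrised curve `γ`. [folklore] -/
theorem exists_unroot_eq (u : UnbasedLoop E) :
    ∃ γ : {γ : Curve E // γ.IsLoop}, Curve.unroot γ = u := by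
  obtain ⟨⟨c, hc⟩, rfl⟩ := mk_surjective u
  obtain ⟨γ, rfl⟩ := CurveClass.surjective_mk c
  exact ⟨⟨γ, hc⟩, rfl⟩

/-- A loop leaving `D` is its own (junk) image. [folklore] -/
theorem imageOn_of_not_subset {u : UnbasedLoop E} (hu : ¬ u.range ⊆ D) : imageOn f D u = u := by
  obtain ⟨⟨γ, hγ⟩, rfl⟩ := exists_unroot_eq u
  rw [imageOn_unroot]
  exact congrArg Curve.unroot (Subtype.ext (Curve.imageOn_of_not_subset (f := f) hu))

/-- If `f` is not continuous on `D`, `imageOn f D` is the identity (junk). [folklore] -/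
theorem imageOn_of_not_continuousOn (hf : ¬ ContinuousOn f D) (u : UnbasedLoop E) :
    imageOn f D u = u := by
  obtain ⟨⟨γ, hγ⟩, rfl⟩ := exists_unroot_eq u
  rw [imageOn_unroot]
  exact congrArg Curve.unroot (Subtype.ext (Curve.imageOn_of_not (γ := γ) fun h ↦ hf h.1))

/-- Off `inside D`, `imageOn f D` is the identity. [folklore] -/
theorem imageOn_of_not_mem {u : UnbasedLoop E} (hu : u ∉ inside D) : imageOn f D u = u :=
  imageOn_of_not_subset hu

/-- **The trace of the image is the image of the trace.** [folklore] -/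
theorem range_imageOn (hf : ContinuousOn f D) {u : UnbasedLoop E} (hu : u.range ⊆ D) :
    (imageOn f D u).range = f '' u.range := by
  obtain ⟨γ, rfl⟩ := exists_unroot_eq u
  rw [imageOn_unroot, Curve.range_unroot, Curve.range_unroot]
  exact Curve.range_imageOn hf hu

/-- Loops in `D` are mapped to loops in `D'` when `f(D) ⊆ D'`. [folklore] -/
theorem mapsTo_imageOn (hf : ContinuousOn f D) (h : MapsTo f D D') :
    MapsTo (imageOn f D) (inside D) (inside D') := by
  intro u hu
  rw [mem_inside] at hu ⊢
  rw [range_imageOn hf hu]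
  exact (image_mono hu).trans h.image_subset

/-- **A left inverse of `f` on `D` induces a left inverse on the loops in `D`.** [folklore] -/
theorem imageOn_imageOn (hf : ContinuousOn f D) (hg : ContinuousOn g D') (hfD : MapsTo f D D')
    (hgf : LeftInvOn g f D) {u : UnbasedLoop E} (hu : u.range ⊆ D) :
    imageOn g D' (imageOn f D u) = u := by
  obtain ⟨⟨γ, hγ⟩, rfl⟩ := exists_unroot_eq u
  rw [imageOn_unroot, imageOn_unroot]
  exact congrArg Curve.unroot (Subtype.ext (Curve.imageOn_imageOn hf hg hfD hgf hu))

/-- **Hitting events are transported**: for `f` injective on `D`, `K ⊆ D` and a loop `u` in `D`,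
the image loop hits `f(K)` iff `u` hits `K` ([Lawler2009] §2.2: the loops in `f(D)` meeting
`f(K₁)` and `f(K₂)` are the images of the loops in `D` meeting `K₁` and `K₂`). [cite: Lawler2009, §2.2] -/
theorem imageOn_mem_hit_image_iff (hf : ContinuousOn f D) (hinj : InjOn f D) {K : Set E}
    (hK : K ⊆ D) {u : UnbasedLoop E} (hu : u.range ⊆ D) :
    imageOn f D u ∈ hit (f '' K) ↔ u ∈ hit K := by
  rw [mem_hit, mem_hit, range_imageOn hf hu, ← hinj.image_inter hu hK, image_nonempty]

/-- **Continuity on the loops in an open set**: for open `D` and `f` continuous on `D`,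
`imageOn f D` is continuous on the open set `inside D`; indeed loops close to a loop `u₀` in `D`
lie in `D` and have images close to the image of `u₀`, by the uniform continuity of `f` near the
compact trace of `u₀` (`exists_forall_dist_lt_of_continuousOn`). [folklore] -/
theorem continuousOn_imageOn (hD : IsOpen D) (hf : ContinuousOn f D) :
    ContinuousOn (imageOn f D) (inside D) := by
  intro u₀ hu₀
  rw [mem_inside] at hu₀
  refine ContinuousAt.continuousWithinAt (Metric.continuousAt_iff.2 fun ε hε ↦ ?_)
  obtain ⟨δ, hδ, hfδ⟩ :=
    exists_forall_dist_lt_of_continuousOn hD hf u₀.isCompact_range hu₀ (half_pos hε)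
  refine ⟨δ, hδ, fun u hu ↦ ?_⟩
  obtain ⟨⟨γ₀, hl₀⟩, rfl⟩ := exists_unroot_eq u₀
  obtain ⟨⟨γ, hl⟩, rfl⟩ := exists_unroot_eq u
  change Curve.loopDist γ γ₀ < δ at hu
  change γ₀.range ⊆ D at hu₀
  obtain ⟨b, hb⟩ : ∃ b : I, Curve.reparamDist γ (γ₀.shift b) < δ := exists_lt_of_ciInf_lt hu
  obtain ⟨φ, hφ⟩ := Curve.exists_dist_reparam_lt (γ₁ := γ) (γ₂ := γ₀.shift b) hb
  have h₀b : (γ₀.shift b).range ⊆ D := by rw [Curve.range_shift]; exact hu₀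
  have hclose : ∀ t, dist (γ t) ((γ₀.shift b) (φ t)) < δ := fun t ↦
    (ContinuousMap.dist_apply_le_dist (f := γ.toContinuousMap)
      (g := ((γ₀.shift b).reparam φ).toContinuousMap) t).trans_lt hφ
  have hmem : ∀ t, (γ₀.shift b) (φ t) ∈ (Curve.unroot ⟨γ₀, hl₀⟩).range := fun t ↦ by
    rw [Curve.range_unroot, ← Curve.range_shift γ₀ b]
    exact ⟨φ t, rfl⟩
  have hγD : γ.range ⊆ D := by
    rintro _ ⟨t, rfl⟩
    exact (hfδ _ (hmem t) _ (hclose t)).1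
  rw [imageOn_unroot, imageOn_unroot]
  change Curve.loopDist (γ.imageOn f D) (γ₀.imageOn f D) < ε
  calc Curve.loopDist (γ.imageOn f D) (γ₀.imageOn f D)
      ≤ Curve.reparamDist (γ.imageOn f D) ((γ₀.imageOn f D).shift b) := Curve.loopDist_le _ _ b
    _ = Curve.reparamDist (γ.imageOn f D) ((γ₀.shift b).imageOn f D) := by
        rw [Curve.imageOn_shift hl₀]
    _ ≤ ε / 2 :=
        Curve.reparamDist_imageOn_le hf hγD h₀b (half_pos hε).le φ fun t ↦
          (hfδ _ (hmem t) _ (hclose t)).2.le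
    _ < ε := half_lt_self hε

/-- **`imageOn f D` is Borel measurable** for open `D`: it is continuous on the open set
`inside D` and the identity off it. [folklore] -/
theorem measurable_imageOn (hD : IsOpen D) : Measurable (imageOn f D) := by
  classical
  by_cases hf : ContinuousOn f D
  · have heq : imageOn f D = (inside D).piecewise (imageOn f D) id := by
      funext u
      by_cases hu : u ∈ inside D
      · rw [piecewise_eq_of_mem _ _ _ hu]
      · rw [piecewise_eq_of_notMem _ _ _ hu, id, imageOn_of_not_mem hu]
    exact heq ▸ (continuousOn_imageOn hD hf).measurable_piecewise continuousOn_id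
      (measurableSet_inside_of_isOpen hD)
  · rw [show imageOn f D = id from funext (imageOn_of_not_continuousOn hf)]
    exact measurable_id

end UnbasedLoop

end Literature.Probability.RandomPlanarGeometry

end
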